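import Summits.CriticalPhenomena.PercolationContinuityZ3.Theorems.PercNearOneGluingAdditiveGluingBystanderGood
import Summits.CriticalPhenomena.PercolationContinuityZ3.Theorems.PercNearOneGluingAdditiveGluingBlockGrowth
import Summits.CriticalPhenomena.PercolationContinuityZ3.Theorems.PercNearOneGluingAdditiveGluingLemma5AnyRelay
import Summits.CriticalPhenomena.PercolationContinuityZ3.Theorems.PercNearOneGluingAdditiveGluingWholeBlockPockets
import HarnessLib

/-! # Crux `PercNearOneGluing.AdditiveGluing` (stmt-CriticalPhenomena-4576), line `peel`, skeleton v8 — the BYSTANDER KERNEL with `HBLK`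

Lead c5; lands `--supports stmt-CriticalPhenomena-4576`.  No definitions, no named facts.

`stub_bystanderKernel_c5`: for a block `S ∋ x'` (a vertex with a positive-weight edge), a minimiser `a₀` of `μ_u(· ↔ b)` over `A`, a
minimiser `a'` of the `x'`-star-killed two-point function, block goodness in every strictly smaller weighting (`HBLK`) and a non-negative
single-bystander certificate `0 ≤ Σ_B μ_u(open star of x' = B)·c_B` (`c_B = designated(a') − designated(a₀)` of the layer block `S∖x' ∪ B`
in `q_B` on layers avoiding `A`, `reach − designated(a₀)` on layers meeting `A`), the block `S` is `a₀`-good (worst selection).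
Proof: the landed weighted bystander lemma (`stub_bystanderLayers_c5`) with these `c_B`; on a relay layer the certificate loses only the
pockets (`≥ 0`); on a relay-free layer of positive mass the layer block is `a'`-good in the star-killed weighting by `HBLK` (`x'` has positive
degree in `u` and degree `0` there), and gluing `B ⊆ S∖x' ∪ B` does not change the block's three quantities (`blockGrowth_glue_real_*`,
absorption `(w/B)/L = w/L`, locality of the pocket factor).  [cite: KozmaNitzan2024, §3.2 pp. 12–14]
-/

namespace Summit.CriticalPhenomena.PercolationContinuityZ3.Theorems

open MeasureTheory Set
open Literature.Probability.LatticeModels (prodBernoulli)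
open Literature.Probability.Percolation (BondConfig openConn openConnIn openGraph openCluster)
open scoped BigOperators

noncomputable section
open Classical

section BystanderKernel

open Literature.Probability.LatticeModels Literature.Probability.Percolation

variable {n : ℕ}

/-- **Locality of the pocket factor**: two weightings agreeing on every pair inside `Wᶜ` give the same mass to `{a ↔ b inside Wᶜ}`. -/
theorem bk_openConnIn_congr (w w' : Sym2 (Fin n) → unitInterval) (W : Finset (Fin n)) (a b : Fin n)
    (h : ∀ e : Sym2 (Fin n), (∀ y ∈ e, y ∉ W) → w e = w' e) :
    (prodBernoulli w).real (openConnIn ((W : Set (Fin n))ᶜ) a b)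
      = (prodBernoulli w').real (openConnIn ((W : Set (Fin n))ᶜ) a b) := by
  refine prodBernoulli_real_eq_of_determinedBy w w' ?_
    (DCT16.determinedBy_openConnIn ((W : Set (Fin n))ᶜ) a b subset_rfl) MeasurableSet.of_discrete
  intro e he
  refine h e ?_
  induction e using Sym2.ind with
  | h a c =>
    intro y hy
    have hac := Set.mk_mem_sym2_iff.1 he
    rcases Sym2.mem_iff.1 hy with rfl | rfl
    · exact fun hW => hac.1 hW
    · exact fun hW => hac.2 hW

/-- **Gluing a block does not change its pocket sum** (worst selection). -/
theorem bk_pockets_glue (u : Sym2 (Fin n) → unitInterval) (A L : Finset (Fin n)) (b : Fin n) (hb : b ∈ A) :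
    (∑ W ∈ (Finset.univ : Finset (Finset (Fin n))).filter (fun W => Disjoint W A),
        (prodBernoulli (fun e : Sym2 (Fin n) => if (∀ y ∈ e, y ∈ L) ∧ ¬ e.IsDiag then 1 else u e)).real
            {ω : BondConfig (Fin n) | ∀ z : Fin n, (z ∈ W ↔ ω ∈ ⋃ v ∈ L, openConn v z)}
          * A.inf' ⟨b, hb⟩ (fun a => (prodBernoulli (fun e : Sym2 (Fin n) =>
              if (∀ y ∈ e, y ∈ L) ∧ ¬ e.IsDiag then 1 else u e)).real (openConnIn ((W : Set (Fin n))ᶜ) a b)))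
      = ∑ W ∈ (Finset.univ : Finset (Finset (Fin n))).filter (fun W => Disjoint W A),
          (prodBernoulli u).real {ω : BondConfig (Fin n) | ∀ z : Fin n, (z ∈ W ↔ ω ∈ ⋃ v ∈ L, openConn v z)}
            * A.inf' ⟨b, hb⟩ (fun a => (prodBernoulli u).real (openConnIn ((W : Set (Fin n))ᶜ) a b)) := by
  refine Finset.sum_congr rfl fun W _ => ?_
  by_cases hLW : L ⊆ W
  · rw [blockGrowth_glue_real_pocket u L W]
    congr 1
    refine Finset.inf'_congr ⟨b, hb⟩ rfl fun a _ => ?_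
    refine bk_openConnIn_congr _ _ W a b fun e he => ?_
    have hnot : ¬ ((∀ y ∈ e, y ∈ L) ∧ ¬ e.IsDiag) := by
      rintro ⟨hall, -⟩
      obtain ⟨y, hy⟩ : ∃ y, y ∈ e := ⟨e.out.1, Sym2.out_fst_mem e⟩
      exact he y hy (hLW (hall y hy))
    simp only [hnot, if_false]
  · simp only [wbP_pocket_eq_empty L W hLW, measureReal_empty, zero_mul]

/-- Killing the stars of a set `X` containing a vertex with a positive-weight edge strictly decreases the number of
positive-degree vertices. -/
theorem bk_card_lt (u : Sym2 (Fin n) → unitInterval) (X : Finset (Fin n)) {o y : Fin n} (ho : o ∈ X)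
    (hoy : (u s(o, y) : ℝ) ≠ 0) :
    (Finset.univ.filter (fun v : Fin n => ∃ y : Fin n,
        0 < ((fun e : Sym2 (Fin n) => if (∃ y ∈ e, y ∈ X) then (0 : unitInterval) else u e) s(y, v) : ℝ))).card
      < (Finset.univ.filter (fun v : Fin n => ∃ y : Fin n, 0 < (u s(y, v) : ℝ))).card := by
  have hval : ∀ y' v : Fin n,
      ((fun e : Sym2 (Fin n) => if (∃ y ∈ e, y ∈ X) then (0 : unitInterval) else u e) s(y', v) : ℝ)
        = if (∃ z ∈ s(y', v), z ∈ X) then 0 else (u s(y', v) : ℝ) := by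
    intro y' v
    by_cases hex : ∃ z ∈ s(y', v), z ∈ X
    · simp only [hex, if_true]
      rfl
    · simp only [hex, if_false]
  have hsub : (Finset.univ.filter (fun v : Fin n => ∃ y : Fin n,
        0 < ((fun e : Sym2 (Fin n) => if (∃ y ∈ e, y ∈ X) then (0 : unitInterval) else u e) s(y, v) : ℝ)))
      ⊆ Finset.univ.filter (fun v : Fin n => ∃ y : Fin n, 0 < (u s(y, v) : ℝ)) := by
    intro v hv
    rw [Finset.mem_filter] at hv ⊢
    obtain ⟨y', hy'⟩ := hv.2
    refine ⟨Finset.mem_univ _, y', ?_⟩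
    rw [hval] at hy'
    by_cases hex : ∃ z ∈ s(y', v), z ∈ X
    · rw [if_pos hex] at hy'
      exact absurd hy' (lt_irrefl _)
    · rwa [if_neg hex] at hy'
  apply Finset.card_lt_card
  rw [Finset.ssubset_iff_of_subset hsub]
  refine ⟨o, Finset.mem_filter.2 ⟨Finset.mem_univ _, y, ?_⟩, fun h => ?_⟩
  · rw [Sym2.eq_swap]
    exact lt_of_le_of_ne (u s(o, y)).2.1 (Ne.symm hoy)
  · obtain ⟨y', hy'⟩ := (Finset.mem_filter.1 h).2
    rw [hval, if_pos ⟨o, Sym2.mem_mk_right y' o, ho⟩] at hy'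
    exact lt_irrefl _ hy'

/-- Registered stub `stub_bystanderKernel_c5` of crux stmt-CriticalPhenomena-4576 (lead c5, line `peel`, skeleton v8): **the bystander
kernel with `HBLK`** — a non-negative single-bystander certificate makes the block `a₀`-good (worst selection).
[cite: KozmaNitzan2024, §3.2 pp. 12–14] -/
theorem stub_bystanderKernel_c5 :
    ∀ (n : ℕ) (u : Sym2 (Fin n) → unitInterval) (A S : Finset (Fin n)) (b a₀ x' a' : Fin n) (hb : b ∈ A),
      Disjoint S A → a₀ ∈ A → x' ∈ S → a' ∈ A →
      (∀ a ∈ A, (prodBernoulli u).real (openConn a₀ b) ≤ (prodBernoulli u).real (openConn a b)) →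
      (∀ a ∈ A, (prodBernoulli (fun e : Sym2 (Fin n) => if (∃ y ∈ e, y ∈ ({x'} : Finset (Fin n))) then (0 : unitInterval) else u e)).real (openConn a' b) ≤ (prodBernoulli (fun e : Sym2 (Fin n) => if (∃ y ∈ e, y ∈ ({x'} : Finset (Fin n))) then (0 : unitInterval) else u e)).real (openConn a b)) →
      (∀ w' : Sym2 (Fin n) → unitInterval,
        (Finset.univ.filter (fun v : Fin n => ∃ y : Fin n, 0 < (w' s(y, v) : ℝ))).card
          < (Finset.univ.filter (fun v : Fin n => ∃ y : Fin n, 0 < (u s(y, v) : ℝ))).card →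
        ∀ (A' S' : Finset (Fin n)) (b' d' : Fin n) (hb' : b' ∈ A'), Disjoint S' A' → d' ∈ A' →
        (∀ a ∈ A', (prodBernoulli w').real (openConn d' b') ≤ (prodBernoulli w').real (openConn a b')) →
        (prodBernoulli w').real (openConn d' b')
          + (prodBernoulli w').real
              ((openConn d' b')ᶜ ∩ (⋃ v ∈ S', openConn d' v) ∩ (⋃ v ∈ S', openConn v b'))
        ≤ (prodBernoulli w').real (⋃ v ∈ S', openConn v b')
          + (∑ W ∈ (Finset.univ : Finset (Finset (Fin n))).filter (fun W => Disjoint W A'),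
              (prodBernoulli w').real
                  {ω : BondConfig (Fin n) | ∀ z : Fin n, (z ∈ W ↔ ω ∈ ⋃ v ∈ S', openConn v z)}
                * A'.inf' ⟨b', hb'⟩ (fun a => (prodBernoulli w').real (openConnIn ((W : Set (Fin n))ᶜ) a b')))) →
      (∃ y : Fin n, (u s(x', y) : ℝ) ≠ 0) →
      0 ≤ ∑ B : Finset (Fin n), (prodBernoulli u).real {ω : BondConfig (Fin n) | ∀ y : Fin n, y ∈ B ↔ (y ∉ ({x'} : Finset (Fin n)) ∧ ∃ o ∈ ({x'} : Finset (Fin n)), s(o, y) ∈ ω)}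
          * (if Disjoint (S.erase x' ∪ B) A then
              ((prodBernoulli (fun e : Sym2 (Fin n) => if (∀ y ∈ e, y ∈ B) ∧ ¬ e.IsDiag then 1 else if (∃ y ∈ e, y ∈ ({x'} : Finset (Fin n))) then 0 else u e)).real (openConn a' b) + (prodBernoulli (fun e : Sym2 (Fin n) => if (∀ y ∈ e, y ∈ B) ∧ ¬ e.IsDiag then 1 else if (∃ y ∈ e, y ∈ ({x'} : Finset (Fin n))) then 0 else u e)).real ((openConn a' b)ᶜ ∩ (⋃ v ∈ (S.erase x' ∪ B), openConn a' v) ∩ (⋃ v ∈ (S.erase x' ∪ B), openConn v b)))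
              - ((prodBernoulli (fun e : Sym2 (Fin n) => if (∀ y ∈ e, y ∈ B) ∧ ¬ e.IsDiag then 1 else if (∃ y ∈ e, y ∈ ({x'} : Finset (Fin n))) then 0 else u e)).real (openConn a₀ b) + (prodBernoulli (fun e : Sym2 (Fin n) => if (∀ y ∈ e, y ∈ B) ∧ ¬ e.IsDiag then 1 else if (∃ y ∈ e, y ∈ ({x'} : Finset (Fin n))) then 0 else u e)).real ((openConn a₀ b)ᶜ ∩ (⋃ v ∈ (S.erase x' ∪ B), openConn a₀ v) ∩ (⋃ v ∈ (S.erase x' ∪ B), openConn v b)))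
            else
              (prodBernoulli (fun e : Sym2 (Fin n) => if (∀ y ∈ e, y ∈ B) ∧ ¬ e.IsDiag then 1 else if (∃ y ∈ e, y ∈ ({x'} : Finset (Fin n))) then 0 else u e)).real (⋃ v ∈ (S.erase x' ∪ B), openConn v b)
              - ((prodBernoulli (fun e : Sym2 (Fin n) => if (∀ y ∈ e, y ∈ B) ∧ ¬ e.IsDiag then 1 else if (∃ y ∈ e, y ∈ ({x'} : Finset (Fin n))) then 0 else u e)).real (openConn a₀ b) + (prodBernoulli (fun e : Sym2 (Fin n) => if (∀ y ∈ e, y ∈ B) ∧ ¬ e.IsDiag then 1 else if (∃ y ∈ e, y ∈ ({x'} : Finset (Fin n))) then 0 else u e)).real ((openConn a₀ b)ᶜ ∩ (⋃ v ∈ (S.erase x' ∪ B), openConn a₀ v) ∩ (⋃ v ∈ (S.erase x' ∪ B), openConn v b)))) →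
      (prodBernoulli u).real (openConn a₀ b)
          + (prodBernoulli u).real
              ((openConn a₀ b)ᶜ ∩ (⋃ v ∈ S, openConn a₀ v) ∩ (⋃ v ∈ S, openConn v b))
        ≤ (prodBernoulli u).real (⋃ v ∈ S, openConn v b)
          + (∑ W ∈ (Finset.univ : Finset (Finset (Fin n))).filter (fun W => Disjoint W A),
              (prodBernoulli u).real
                  {ω : BondConfig (Fin n) | ∀ z : Fin n, (z ∈ W ↔ ω ∈ ⋃ v ∈ S, openConn v z)}
                * A.inf' ⟨b, hb⟩ (fun a => (prodBernoulli u).real (openConnIn ((W : Set (Fin n))ᶜ) a b))) := by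
  intro n u A S b a₀ x' a' hb hSA ha₀ hx' ha' hmin hmin' hblk hy hsum
  have hx'A : x' ∉ A := Finset.disjoint_left.1 hSA hx'
  have ha₀x : a₀ ≠ x' := fun h => hx'A (h ▸ ha₀)
  have hxT : x' ∉ S.erase x' := Finset.notMem_erase x' S
  obtain ⟨y₀, hy₀⟩ := hy
  rw [← Finset.insert_erase hx']
  refine stub_bystanderLayers_c5 n u A (S.erase x') x' b a₀ hb
    (fun B => if Disjoint (S.erase x' ∪ B) A then
              ((prodBernoulli (fun e : Sym2 (Fin n) => if (∀ y ∈ e, y ∈ B) ∧ ¬ e.IsDiag then 1 else if (∃ y ∈ e, y ∈ ({x'} : Finset (Fin n))) then 0 else u e)).real (openConn a' b) + (prodBernoulli (fun e : Sym2 (Fin n) => if (∀ y ∈ e, y ∈ B) ∧ ¬ e.IsDiag then 1 else if (∃ y ∈ e, y ∈ ({x'} : Finset (Fin n))) then 0 else u e)).real ((openConn a' b)ᶜ ∩ (⋃ v ∈ (S.erase x' ∪ B), openConn a' v) ∩ (⋃ v ∈ (S.erase x' ∪ B), openConn v b)))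
              - ((prodBernoulli (fun e : Sym2 (Fin n) => if (∀ y ∈ e, y ∈ B) ∧ ¬ e.IsDiag then 1 else if (∃ y ∈ e, y ∈ ({x'} : Finset (Fin n))) then 0 else u e)).real (openConn a₀ b) + (prodBernoulli (fun e : Sym2 (Fin n) => if (∀ y ∈ e, y ∈ B) ∧ ¬ e.IsDiag then 1 else if (∃ y ∈ e, y ∈ ({x'} : Finset (Fin n))) then 0 else u e)).real ((openConn a₀ b)ᶜ ∩ (⋃ v ∈ (S.erase x' ∪ B), openConn a₀ v) ∩ (⋃ v ∈ (S.erase x' ∪ B), openConn v b)))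
            else
              (prodBernoulli (fun e : Sym2 (Fin n) => if (∀ y ∈ e, y ∈ B) ∧ ¬ e.IsDiag then 1 else if (∃ y ∈ e, y ∈ ({x'} : Finset (Fin n))) then 0 else u e)).real (⋃ v ∈ (S.erase x' ∪ B), openConn v b)
              - ((prodBernoulli (fun e : Sym2 (Fin n) => if (∀ y ∈ e, y ∈ B) ∧ ¬ e.IsDiag then 1 else if (∃ y ∈ e, y ∈ ({x'} : Finset (Fin n))) then 0 else u e)).real (openConn a₀ b) + (prodBernoulli (fun e : Sym2 (Fin n) => if (∀ y ∈ e, y ∈ B) ∧ ¬ e.IsDiag then 1 else if (∃ y ∈ e, y ∈ ({x'} : Finset (Fin n))) then 0 else u e)).real ((openConn a₀ b)ᶜ ∩ (⋃ v ∈ (S.erase x' ∪ B), openConn a₀ v) ∩ (⋃ v ∈ (S.erase x' ∪ B), openConn v b)))) hxT hx'A ha₀x hsum ?_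
  intro B hB
  have hpk0 : 0 ≤ (∑ W ∈ (Finset.univ : Finset (Finset (Fin n))).filter (fun W => Disjoint W A),
              (prodBernoulli (fun e : Sym2 (Fin n) => if (∀ y ∈ e, y ∈ B) ∧ ¬ e.IsDiag then 1 else if (∃ y ∈ e, y ∈ ({x'} : Finset (Fin n))) then 0 else u e)).real
                  {ω : BondConfig (Fin n) | ∀ z : Fin n, (z ∈ W ↔ ω ∈ ⋃ v ∈ (S.erase x' ∪ B), openConn v z)}
                * A.inf' ⟨b, hb⟩ (fun a => (prodBernoulli (fun e : Sym2 (Fin n) => if (∀ y ∈ e, y ∈ B) ∧ ¬ e.IsDiag then 1 else if (∃ y ∈ e, y ∈ ({x'} : Finset (Fin n))) then 0 else u e)).real (openConnIn ((W : Set (Fin n))ᶜ) a b))) :=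
    Finset.sum_nonneg fun W _ => mul_nonneg measureReal_nonneg (Finset.le_inf' _ _ fun a _ => measureReal_nonneg)
  show (if Disjoint (S.erase x' ∪ B) A then
              ((prodBernoulli (fun e : Sym2 (Fin n) => if (∀ y ∈ e, y ∈ B) ∧ ¬ e.IsDiag then 1 else if (∃ y ∈ e, y ∈ ({x'} : Finset (Fin n))) then 0 else u e)).real (openConn a' b) + (prodBernoulli (fun e : Sym2 (Fin n) => if (∀ y ∈ e, y ∈ B) ∧ ¬ e.IsDiag then 1 else if (∃ y ∈ e, y ∈ ({x'} : Finset (Fin n))) then 0 else u e)).real ((openConn a' b)ᶜ ∩ (⋃ v ∈ (S.erase x' ∪ B), openConn a' v) ∩ (⋃ v ∈ (S.erase x' ∪ B), openConn v b)))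
              - ((prodBernoulli (fun e : Sym2 (Fin n) => if (∀ y ∈ e, y ∈ B) ∧ ¬ e.IsDiag then 1 else if (∃ y ∈ e, y ∈ ({x'} : Finset (Fin n))) then 0 else u e)).real (openConn a₀ b) + (prodBernoulli (fun e : Sym2 (Fin n) => if (∀ y ∈ e, y ∈ B) ∧ ¬ e.IsDiag then 1 else if (∃ y ∈ e, y ∈ ({x'} : Finset (Fin n))) then 0 else u e)).real ((openConn a₀ b)ᶜ ∩ (⋃ v ∈ (S.erase x' ∪ B), openConn a₀ v) ∩ (⋃ v ∈ (S.erase x' ∪ B), openConn v b)))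
            else
              (prodBernoulli (fun e : Sym2 (Fin n) => if (∀ y ∈ e, y ∈ B) ∧ ¬ e.IsDiag then 1 else if (∃ y ∈ e, y ∈ ({x'} : Finset (Fin n))) then 0 else u e)).real (⋃ v ∈ (S.erase x' ∪ B), openConn v b)
              - ((prodBernoulli (fun e : Sym2 (Fin n) => if (∀ y ∈ e, y ∈ B) ∧ ¬ e.IsDiag then 1 else if (∃ y ∈ e, y ∈ ({x'} : Finset (Fin n))) then 0 else u e)).real (openConn a₀ b) + (prodBernoulli (fun e : Sym2 (Fin n) => if (∀ y ∈ e, y ∈ B) ∧ ¬ e.IsDiag then 1 else if (∃ y ∈ e, y ∈ ({x'} : Finset (Fin n))) then 0 else u e)).real ((openConn a₀ b)ᶜ ∩ (⋃ v ∈ (S.erase x' ∪ B), openConn a₀ v) ∩ (⋃ v ∈ (S.erase x' ∪ B), openConn v b)))) ≤ _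
  split_ifs with hdisj
  · -- relay-free layer: the layer block is `a'`-good in the star-killed weighting (`HBLK`), then glue `B`
    suffices hgoal : ((prodBernoulli (fun e : Sym2 (Fin n) => if (∀ y ∈ e, y ∈ B) ∧ ¬ e.IsDiag then 1 else if (∃ y ∈ e, y ∈ ({x'} : Finset (Fin n))) then 0 else u e)).real (openConn a' b) + (prodBernoulli (fun e : Sym2 (Fin n) => if (∀ y ∈ e, y ∈ B) ∧ ¬ e.IsDiag then 1 else if (∃ y ∈ e, y ∈ ({x'} : Finset (Fin n))) then 0 else u e)).real ((openConn a' b)ᶜ ∩ (⋃ v ∈ (S.erase x' ∪ B), openConn a' v) ∩ (⋃ v ∈ (S.erase x' ∪ B), openConn v b)))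
        ≤ (prodBernoulli (fun e : Sym2 (Fin n) => if (∀ y ∈ e, y ∈ B) ∧ ¬ e.IsDiag then 1 else if (∃ y ∈ e, y ∈ ({x'} : Finset (Fin n))) then 0 else u e)).real (⋃ v ∈ (S.erase x' ∪ B), openConn v b)
          + (∑ W ∈ (Finset.univ : Finset (Finset (Fin n))).filter (fun W => Disjoint W A),
              (prodBernoulli (fun e : Sym2 (Fin n) => if (∀ y ∈ e, y ∈ B) ∧ ¬ e.IsDiag then 1 else if (∃ y ∈ e, y ∈ ({x'} : Finset (Fin n))) then 0 else u e)).real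
                  {ω : BondConfig (Fin n) | ∀ z : Fin n, (z ∈ W ↔ ω ∈ ⋃ v ∈ (S.erase x' ∪ B), openConn v z)}
                * A.inf' ⟨b, hb⟩ (fun a => (prodBernoulli (fun e : Sym2 (Fin n) => if (∀ y ∈ e, y ∈ B) ∧ ¬ e.IsDiag then 1 else if (∃ y ∈ e, y ∈ ({x'} : Finset (Fin n))) then 0 else u e)).real (openConnIn ((W : Set (Fin n))ᶜ) a b))) by
      linarith
    have hlt := bk_card_lt u ({x'} : Finset (Fin n)) (Finset.mem_singleton_self x') hy₀
    have hgood := hblk (fun e : Sym2 (Fin n) => if (∃ y ∈ e, y ∈ ({x'} : Finset (Fin n))) then (0 : unitInterval) else u e) hlt A (S.erase x' ∪ B) b a' hb hdisj ha' hmin'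
    -- absorption: gluing the layer block after gluing `B ⊆` it is gluing the layer block
    have habs : (fun e : Sym2 (Fin n) => if (∀ y ∈ e, y ∈ (S.erase x' ∪ B)) ∧ ¬ e.IsDiag then 1 else if (∀ y ∈ e, y ∈ B) ∧ ¬ e.IsDiag then 1 else if (∃ y ∈ e, y ∈ ({x'} : Finset (Fin n))) then 0 else u e)
        = (fun e : Sym2 (Fin n) => if (∀ y ∈ e, y ∈ (S.erase x' ∪ B)) ∧ ¬ e.IsDiag then 1 else if (∃ y ∈ e, y ∈ ({x'} : Finset (Fin n))) then (0 : unitInterval) else u e) := by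
      funext e
      by_cases h1 : (∀ y ∈ e, y ∈ (S.erase x' ∪ B)) ∧ ¬ e.IsDiag
      · rw [if_pos h1, if_pos h1]
      · have h2 : ¬ ((∀ y ∈ e, y ∈ B) ∧ ¬ e.IsDiag) := fun h => h1 ⟨fun y hy => Finset.mem_union_right _ (h.1 y hy), h.2⟩
        rw [if_neg h1, if_neg h1, if_neg h2]
    have hdes : ((prodBernoulli (fun e : Sym2 (Fin n) => if (∀ y ∈ e, y ∈ B) ∧ ¬ e.IsDiag then 1 else if (∃ y ∈ e, y ∈ ({x'} : Finset (Fin n))) then 0 else u e)).real (openConn a' b) + (prodBernoulli (fun e : Sym2 (Fin n) => if (∀ y ∈ e, y ∈ B) ∧ ¬ e.IsDiag then 1 else if (∃ y ∈ e, y ∈ ({x'} : Finset (Fin n))) then 0 else u e)).real ((openConn a' b)ᶜ ∩ (⋃ v ∈ (S.erase x' ∪ B), openConn a' v) ∩ (⋃ v ∈ (S.erase x' ∪ B), openConn v b)))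
        = ((prodBernoulli (fun e : Sym2 (Fin n) => if (∃ y ∈ e, y ∈ ({x'} : Finset (Fin n))) then (0 : unitInterval) else u e)).real (openConn a' b) + (prodBernoulli (fun e : Sym2 (Fin n) => if (∃ y ∈ e, y ∈ ({x'} : Finset (Fin n))) then (0 : unitInterval) else u e)).real ((openConn a' b)ᶜ ∩ (⋃ v ∈ (S.erase x' ∪ B), openConn a' v) ∩ (⋃ v ∈ (S.erase x' ∪ B), openConn v b))) := by
      have h1 := blockGrowth_glue_real_openConn (fun e : Sym2 (Fin n) => if (∀ y ∈ e, y ∈ B) ∧ ¬ e.IsDiag then 1 else if (∃ y ∈ e, y ∈ ({x'} : Finset (Fin n))) then 0 else u e) (S.erase x' ∪ B) a' b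
      have h2 := blockGrowth_glue_real_openConn (fun e : Sym2 (Fin n) => if (∃ y ∈ e, y ∈ ({x'} : Finset (Fin n))) then (0 : unitInterval) else u e) (S.erase x' ∪ B) a' b
      rw [habs] at h1
      exact h1.symm.trans h2
    have hreach : (prodBernoulli (fun e : Sym2 (Fin n) => if (∀ y ∈ e, y ∈ B) ∧ ¬ e.IsDiag then 1 else if (∃ y ∈ e, y ∈ ({x'} : Finset (Fin n))) then 0 else u e)).real (⋃ v ∈ (S.erase x' ∪ B), openConn v b)
        = (prodBernoulli (fun e : Sym2 (Fin n) => if (∃ y ∈ e, y ∈ ({x'} : Finset (Fin n))) then (0 : unitInterval) else u e)).real (⋃ v ∈ (S.erase x' ∪ B), openConn v b) := by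
      have h1 := blockGrowth_glue_real_iUnion (fun e : Sym2 (Fin n) => if (∀ y ∈ e, y ∈ B) ∧ ¬ e.IsDiag then 1 else if (∃ y ∈ e, y ∈ ({x'} : Finset (Fin n))) then 0 else u e) (S.erase x' ∪ B) b
      have h2 := blockGrowth_glue_real_iUnion (fun e : Sym2 (Fin n) => if (∃ y ∈ e, y ∈ ({x'} : Finset (Fin n))) then (0 : unitInterval) else u e) (S.erase x' ∪ B) b
      rw [habs] at h1
      exact h1.symm.trans h2
    have hpock : (∑ W ∈ (Finset.univ : Finset (Finset (Fin n))).filter (fun W => Disjoint W A),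
              (prodBernoulli (fun e : Sym2 (Fin n) => if (∀ y ∈ e, y ∈ B) ∧ ¬ e.IsDiag then 1 else if (∃ y ∈ e, y ∈ ({x'} : Finset (Fin n))) then 0 else u e)).real
                  {ω : BondConfig (Fin n) | ∀ z : Fin n, (z ∈ W ↔ ω ∈ ⋃ v ∈ (S.erase x' ∪ B), openConn v z)}
                * A.inf' ⟨b, hb⟩ (fun a => (prodBernoulli (fun e : Sym2 (Fin n) => if (∀ y ∈ e, y ∈ B) ∧ ¬ e.IsDiag then 1 else if (∃ y ∈ e, y ∈ ({x'} : Finset (Fin n))) then 0 else u e)).real (openConnIn ((W : Set (Fin n))ᶜ) a b)))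
        = (∑ W ∈ (Finset.univ : Finset (Finset (Fin n))).filter (fun W => Disjoint W A),
              (prodBernoulli (fun e : Sym2 (Fin n) => if (∃ y ∈ e, y ∈ ({x'} : Finset (Fin n))) then (0 : unitInterval) else u e)).real
                  {ω : BondConfig (Fin n) | ∀ z : Fin n, (z ∈ W ↔ ω ∈ ⋃ v ∈ (S.erase x' ∪ B), openConn v z)}
                * A.inf' ⟨b, hb⟩ (fun a => (prodBernoulli (fun e : Sym2 (Fin n) => if (∃ y ∈ e, y ∈ ({x'} : Finset (Fin n))) then (0 : unitInterval) else u e)).real (openConnIn ((W : Set (Fin n))ᶜ) a b))) := by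
      have h1 := bk_pockets_glue (fun e : Sym2 (Fin n) => if (∀ y ∈ e, y ∈ B) ∧ ¬ e.IsDiag then 1 else if (∃ y ∈ e, y ∈ ({x'} : Finset (Fin n))) then 0 else u e) A (S.erase x' ∪ B) b hb
      have h2 := bk_pockets_glue (fun e : Sym2 (Fin n) => if (∃ y ∈ e, y ∈ ({x'} : Finset (Fin n))) then (0 : unitInterval) else u e) A (S.erase x' ∪ B) b hb
      rw [habs] at h1
      exact h1.symm.trans h2
    rw [hdes, hreach, hpock]
    exact hgood
  · -- relay layer: only the pockets are lost
    linarith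

end BystanderKernel

end

end Summit.CriticalPhenomena.PercolationContinuityZ3.Theorems
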